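import Literature.NumberTheory.GaloisRepresentations.LubinTateColemanRelativeCoordTwo
import Literature.NumberTheory.GaloisRepresentations.LubinTateColemanRelativeGaloisActionTwo
import Literature.NumberTheory.GaloisRepresentations.LubinTateColemanCoordGaloisTwo
import HarnessLib

/-!
# `q = 2`, relative situation: de Shalit's Lemma I.3.4 (ii) over the unramified base `k' = E` —
# `δ(σβ) = χ(σ)·(δβ) ∘ [χ(σ)]`, `(δ(σβ))~ = χ(σ)·(δβ)~ ∘ [χ(σ)]`, `r_{σβ} = χ(σ)·ρ_{χ(σ)}·(r_β ∘ [χ(σ)])`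

De Shalit, *Iwasawa theory of elliptic curves with complex multiplication* (1987), Ch. I §3.4 Lemma (ii) /
§3.5 (ii): `μ_{γβ}(γU) = μ_β(U)` — the Coleman map `i : 𝒰 → Λ` is equivariant for `G = Gal(k'(W_f)/k')` acting
through `κ`.  On the power-series side over the unramified base `E` (`f = πX + X²`, `|𝓀_F| = 2`, `π = 2u`; relative
Coleman series `g_β ∈ 𝒪_E⟦X⟧` with `g_{σ̃β} = g_β ∘ [χ_π(σ̃)]_f` for `σ̃ ∈ Γ_F` fixing `E`,
`LubinTateColemanRelativeGaloisActionTwo`; `δβ = δ_E g_β`, `(δβ)~ = δβ − u·((δβ)^φ ∘ f) = (1 + u⁻¹X)·(r_β ∘ f)`,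
`LubinTateColemanRelativeCoordTwo`) this file transports the action to `δβ`, `(δβ)~` and the coordinate `r_β`:

* `relLogDeriv_eq_of_eq_subst_homE` — **`δ_E(G ∘ [a]_f) = a · (δ_E G) ∘ [a]_f`** (`𝒪_F`-equivariance of the
  invariant derivation, read in `𝒪_E⟦X⟧`);
* ★ `relLogDerivSeries_galAct` — **`δ(σ̃β) = χ_π(σ̃) · (δβ) ∘ [χ_π(σ̃)]_f`** (`σ̃|_E = id`): the input `(R2)` of the
  measure-side instantiation (`PAdicOneVariableSeriesFamily*`: `hgal`);
* ★ `relTildeSeries_galAct` — **`(δ(σ̃β))~ = χ_π(σ̃) · (δβ)~ ∘ [χ_π(σ̃)]_f`** (the Frobenius twist commutes with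
  `∘ [v]_f`, and `[v] ∘ f = f ∘ [v]`);
* ★★ `relUnitCoordTwo_galAct` — **`r_{σ̃β} = χ_π(σ̃) · ρ_{χ_π(σ̃)} · (r_β ∘ [χ_π(σ̃)]_f)`** with `ρ_v ∈ 𝒪_F⟦Y⟧ˣ` the unit
  series of `LubinTateColemanCoordGaloisTwo` (`(1 + u⁻¹X)(ρ_v ∘ f) = 1 + u⁻¹[v]_f`): the SEMILINEAR action of
  `Gal(E·K_π^∞/E) ≅ 𝒪_F^×` on the free rank-one coordinate module `𝒪_E⟦Y⟧` making `β ↦ r_β` equivariant — de Shalit's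
  Lemma 3.4 (ii) over `k'` in coordinates.

0 sorry, no named facts.

## References

* E. de Shalit, *Iwasawa theory of elliptic curves with complex multiplication* (1987), Ch. I §3.4 Lemma (ii),
  §3.5 (ii), §3.7. [deShalit1987]

## Tree reuse

`relColemanSeries_galAct` (`…RelativeGaloisActionTwo`), `homE`, `map_subst_homE` (`…RelativeGaloisTwo`),
`invDiff_mul_derivative_hom` (`LubinTateInvariantDifferential`), `subst_hom` (`LubinTate`),
`one_add_mul_subst_evenPartTwo_unitTwistSerTwo`, `unitTwistSerTwo` (`…CoordGaloisTwo`), `eq_relUnitCoordTwo`,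
`relTildeSeries_eq_relUnitCoordTwo` (`…RelativeCoordTwo`).
-/

noncomputable section

open scoped PowerSeries.WithPiTopology

namespace Literature.NumberTheory.GaloisRepresentations

/-- `d⁄dX` commutes with coefficientwise maps (private copy of a tree one-liner). [folklore] -/
private theorem derivative_map₃ {R T : Type*} [CommRing R] [CommRing T] (φ : R →+* T) (G : PowerSeries R) :
    PowerSeries.derivative T (G.map φ) = (PowerSeries.derivative R G).map φ := by
  ext n
  simp only [PowerSeries.coeff_derivative, PowerSeries.coeff_map, map_mul, map_add, map_natCast, map_one]

section RelativeCoordGaloisTwo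

open GaloisRepresentations.IsNonarchimedeanLocalField LubinTate ValuativeRel Field

variable {F : Type} [Field F] [ValuativeRel F] [TopologicalSpace F] [IsNonarchimedeanLocalField F]

attribute [local instance] ltNormUniformSpace ltNormIsUniformAddGroup rk1 nF nE fintypeResidueField

variable {π : 𝒪[F]} (hπ : (valuation F).IsUniformizer (π : F))
variable (E : IntermediateField F (AlgebraicClosure F)) [FiniteDimensional F E]

/-! ### `[v]_f` in `𝒪_E⟦X⟧`: substitutability and `[v] ∘ f = f ∘ [v]` -/

/-- `[v]_f` is substitutable (`[v]_f(0) = 0`). [cite: deShalit1987, Ch. I §1.5] -/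
theorem hasSubst_homE (v : 𝒪[F]) : PowerSeries.HasSubst (homE hπ E v) :=
  PowerSeries.HasSubst.of_constantCoeff_zero' (constantCoeff_homE hπ E v)

/-- `f` (read in `𝒪_E⟦X⟧`) is substitutable (`f(0) = 0`). [cite: deShalit1987, Ch. I §1.2] -/
theorem hasSubst_map_ltSer :
    PowerSeries.HasSubst ((ltSer F π).map (algebraMap (LTCoeff F) (unitBall E))) :=
  PowerSeries.HasSubst.of_constantCoeff_zero' ((isLTSeries_ltSer π).map _).constantCoeff_eq_zero

/-- **`f ∘ [v]_f = [v]_f ∘ f` in `𝒪_E⟦X⟧`** (`[v]_f` is an endomorphism of `F_f`). [cite: deShalit1987, Ch. I §1.5] -/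
theorem subst_homE_map_ltSer (v : 𝒪[F]) :
    PowerSeries.subst (homE hπ E v) ((ltSer F π).map (algebraMap (LTCoeff F) (unitBall E))) =
      PowerSeries.subst ((ltSer F π).map (algebraMap (LTCoeff F) (unitBall E))) (homE hπ E v) := by
  have hf : PowerSeries.HasSubst (ltSer F π) :=
    PowerSeries.HasSubst.of_constantCoeff_zero' (isLTSeries_ltSer π).constantCoeff_eq_zero
  have hh : PowerSeries.HasSubst (hom (isLTRing_LTCoeff hπ) (isLTSeries_LTCoeff π) (isLTSeries_LTCoeff π) (LTCoeff.of F v)) :=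
    PowerSeries.HasSubst.of_constantCoeff_zero' (constantCoeff_hom _ _ _ _)
  have h := congrArg (PowerSeries.map (algebraMap (LTCoeff F) (unitBall E)))
    (subst_hom (isLTRing_LTCoeff hπ) (isLTSeries_LTCoeff π) (isLTSeries_LTCoeff π) (LTCoeff.of F v))
  have e1 : PowerSeries.map (algebraMap (LTCoeff F) (unitBall E))
      (PowerSeries.subst (hom (isLTRing_LTCoeff hπ) (isLTSeries_LTCoeff π) (isLTSeries_LTCoeff π) (LTCoeff.of F v))
        (ltSer F π)) =
      PowerSeries.subst (homE hπ E v) ((ltSer F π).map (algebraMap (LTCoeff F) (unitBall E))) :=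
    PowerSeries.map_subst hh _
  have e2 : PowerSeries.map (algebraMap (LTCoeff F) (unitBall E))
      (PowerSeries.subst (ltSer F π)
        (hom (isLTRing_LTCoeff hπ) (isLTSeries_LTCoeff π) (isLTSeries_LTCoeff π) (LTCoeff.of F v))) =
      PowerSeries.subst ((ltSer F π).map (algebraMap (LTCoeff F) (unitBall E))) (homE hπ E v) :=
    PowerSeries.map_subst hf _
  rw [e1, e2] at h
  exact h

/-- **`(G ∘ f) ∘ [v] = (G ∘ [v]) ∘ f`** for `G ∈ 𝒪_E⟦X⟧`. [cite: deShalit1987, Ch. I §1.5] -/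
theorem subst_homE_subst_map_ltSer (v : 𝒪[F]) (G : PowerSeries (unitBall E)) :
    PowerSeries.subst (homE hπ E v) (PowerSeries.subst ((ltSer F π).map (algebraMap (LTCoeff F) (unitBall E))) G) =
      PowerSeries.subst ((ltSer F π).map (algebraMap (LTCoeff F) (unitBall E))) (PowerSeries.subst (homE hπ E v) G) := by
  rw [PowerSeries.subst_comp_subst_apply (hasSubst_map_ltSer E) (hasSubst_homE hπ E v),
    PowerSeries.subst_comp_subst_apply (hasSubst_homE hπ E v) (hasSubst_map_ltSer E), subst_homE_map_ltSer]

/-- `subst` along `[v]_f` fixes constants: `(C c) ∘ [v]_f = C c`. [cite: deShalit1987, Ch. I §1.5] -/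
theorem subst_homE_C (v : 𝒪[F]) (c : unitBall E) :
    PowerSeries.subst (homE hπ E v) (PowerSeries.C c) = PowerSeries.C c := by
  rw [← PowerSeries.coe_substAlgHom (hasSubst_homE hπ E v), PowerSeries.C_eq_algebraMap, AlgHom.commutes]

/-- `subst` along `f` fixes constants: `(C c) ∘ f = C c`. [cite: deShalit1987, Ch. I §1.2] -/
theorem subst_map_ltSer_C (c : unitBall E) :
    PowerSeries.subst ((ltSer F π).map (algebraMap (LTCoeff F) (unitBall E))) (PowerSeries.C c) = PowerSeries.C c := by
  rw [← PowerSeries.coe_substAlgHom (hasSubst_map_ltSer E), PowerSeries.C_eq_algebraMap, AlgHom.commutes]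

/-! ### `δ_E(G ∘ [a]_f) = a · (δ_E G) ∘ [a]_f` -/

/-- **`ι ω_F · ([a]_f)' = a · (ι ω_F) ∘ [a]_f`** in `𝒪_E⟦X⟧` (`[a]`-equivariance of the invariant derivation).
[cite: deShalit1987, Ch. I §3.5] -/
theorem map_invDiff_mul_derivative_homE (a : 𝒪[F]) :
    (invDiff (isLTRing_LTCoeff hπ) (isLTSeries_LTCoeff π)).map (algebraMap (LTCoeff F) (unitBall E)) *
        PowerSeries.derivative (unitBall E) (homE hπ E a) =
      PowerSeries.C (algebraMap 𝒪[F] (unitBall E) a) *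
        ((invDiff (isLTRing_LTCoeff hπ) (isLTSeries_LTCoeff π)).map (algebraMap (LTCoeff F) (unitBall E))).subst
          (homE hπ E a) := by
  have hh : PowerSeries.HasSubst (hom (isLTRing_LTCoeff hπ) (isLTSeries_LTCoeff π) (isLTSeries_LTCoeff π) (LTCoeff.of F a)) :=
    PowerSeries.HasSubst.of_constantCoeff_zero' (constantCoeff_hom _ _ _ _)
  have key := invDiff_mul_derivative_hom (S := unitBall (ltField π 0)) (isLTRing_LTCoeff hπ)
    (isLTSeries_LTCoeff π) (algebraMap_LTCoeff_injective (ltField π 0)) (LTCoeff.of F a)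
  have h := congrArg (PowerSeries.map (algebraMap (LTCoeff F) (unitBall E))) key
  have e : PowerSeries.map (algebraMap (LTCoeff F) (unitBall E))
      (PowerSeries.subst (hom (isLTRing_LTCoeff hπ) (isLTSeries_LTCoeff π) (isLTSeries_LTCoeff π) (LTCoeff.of F a))
        (invDiff (isLTRing_LTCoeff hπ) (isLTSeries_LTCoeff π))) =
      PowerSeries.subst (homE hπ E a)
        ((invDiff (isLTRing_LTCoeff hπ) (isLTSeries_LTCoeff π)).map (algebraMap (LTCoeff F) (unitBall E))) :=
    PowerSeries.map_subst hh _
  rw [map_mul, map_mul, PowerSeries.map_C, e, ← derivative_map₃] at h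
  exact h

/-- ★ **`𝒪_F`-equivariance of `δ_E`**: `δ_E(G ∘ [a]_f) = a · (δ_E G) ∘ [a]_f` for units `G, H = G ∘ [a]_f` of `𝒪_E⟦X⟧`.
[cite: deShalit1987, Ch. I §3.5] -/
theorem relLogDeriv_eq_of_eq_subst_homE (a : 𝒪[F]) (G H : (PowerSeries (unitBall E))ˣ)
    (hH : (H : PowerSeries (unitBall E)) = (G : PowerSeries (unitBall E)).subst (homE hπ E a)) :
    relLogDeriv hπ E H = PowerSeries.C (algebraMap 𝒪[F] (unitBall E) a) * (relLogDeriv hπ E G).subst (homE hπ E a) := by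
  have hs := hasSubst_homE hπ E a
  rw [relLogDeriv_def, relLogDeriv_def, PowerSeries.dlog_eq_of_subst_eq hs G H hH, PowerSeries.subst_mul hs]
  calc (invDiff (isLTRing_LTCoeff hπ) (isLTSeries_LTCoeff π)).map (algebraMap (LTCoeff F) (unitBall E)) *
        ((PowerSeries.dlog G).subst (homE hπ E a) * PowerSeries.derivative (unitBall E) (homE hπ E a))
      = ((invDiff (isLTRing_LTCoeff hπ) (isLTSeries_LTCoeff π)).map (algebraMap (LTCoeff F) (unitBall E)) *
          PowerSeries.derivative (unitBall E) (homE hπ E a)) * (PowerSeries.dlog G).subst (homE hπ E a) := by ring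
    _ = PowerSeries.C (algebraMap 𝒪[F] (unitBall E) a) *
          ((invDiff (isLTRing_LTCoeff hπ) (isLTSeries_LTCoeff π)).map (algebraMap (LTCoeff F) (unitBall E))).subst
            (homE hπ E a) * (PowerSeries.dlog G).subst (homE hπ E a) := by rw [map_invDiff_mul_derivative_homE]
    _ = _ := by ring

/-! ### `δ(σ̃β)`, `(δ(σ̃β))~` -/

variable [Normal F E] [IsGalois F E] (hq : residueFieldCard F = 2) (hE : E ≤ maxUnramified F)
  {σ₀ : absoluteGaloisGroup F} (hσ₀ : IsAbsArithFrob σ₀)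

/-- ★ **`δ(σ̃·β) = χ_π(σ̃) · (δβ) ∘ [χ_π(σ̃)]_f`** for `σ̃ ∈ Γ_F` fixing `E` pointwise (from `g_{σ̃β} = g_β ∘ [χ_π(σ̃)]_f`):
the `𝒪_F^×`-semilinearity of `δ` over the unramified base — de Shalit's Lemma I.3.4 (ii) / §3.5 (ii).
[cite: deShalit1987, Ch. I §3.4 Lemma (ii)] -/
theorem relLogDerivSeries_galAct (β : RelNormCoherentUnits hπ E) {σ : absoluteGaloisGroup F}
    (hσE : ∀ x : E, σ • (x : AlgebraicClosure F) = x) :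
    relLogDerivSeries hπ E hq hE hσ₀ (β.galAct σ) =
      PowerSeries.C (algebraMap 𝒪[F] (unitBall E) (lubinTateChar hπ σ : 𝒪[F])) *
        (relLogDerivSeries hπ E hq hE hσ₀ β).subst (homE hπ E (lubinTateChar hπ σ : 𝒪[F])) :=
  relLogDeriv_eq_of_eq_subst_homE hπ E _ _ _ (by
    rw [IsUnit.unit_spec, IsUnit.unit_spec, relColemanSeries_galAct hπ E hq hE hσ₀ β hσE])

omit [IsGalois F E] in
/-- The Frobenius of `𝒪_E` fixes `𝒪_F`. [cite: deShalit1987, Ch. I §1.1] -/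
theorem frobUnitBall_algebraMap (σ₀ : absoluteGaloisGroup F) (a : 𝒪[F]) :
    (frobUnitBall E σ₀ : unitBall E →+* unitBall E) (algebraMap 𝒪[F] (unitBall E) a) = algebraMap 𝒪[F] (unitBall E) a :=
  unitBallEquiv_algebraMap E _ a

/-- ★ **`(δ(σ̃·β))~ = χ_π(σ̃) · (δβ)~ ∘ [χ_π(σ̃)]_f`**: `h ↦ h̃ = h − u·(h^φ ∘ f)` commutes with `h ↦ h ∘ [v]_f`
(`(h ∘ [v])^φ = h^φ ∘ [v]`, `(h^φ ∘ f) ∘ [v] = (h^φ ∘ [v]) ∘ f`) and is `𝒪_E`-linear. [cite: deShalit1987, Ch. I §3.4 Lemma (ii)] -/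
theorem relTildeSeries_galAct (u : LTCoeff F) (β : RelNormCoherentUnits hπ E) {σ : absoluteGaloisGroup F}
    (hσE : ∀ x : E, σ • (x : AlgebraicClosure F) = x) :
    relTildeSeries hπ E hq hE hσ₀ u (β.galAct σ) =
      PowerSeries.C (algebraMap 𝒪[F] (unitBall E) (lubinTateChar hπ σ : 𝒪[F])) *
        (relTildeSeries hπ E hq hE hσ₀ u β).subst (homE hπ E (lubinTateChar hπ σ : 𝒪[F])) := by
  set v : 𝒪[F] := (lubinTateChar hπ σ : 𝒪[F]) with hv
  have hsv := hasSubst_homE hπ E v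
  have hsf : PowerSeries.HasSubst ((ltSer F π).map (algebraMap (LTCoeff F) (unitBall E))) := hasSubst_map_ltSer E
  rw [relTildeSeries, relTildeSeries, relLogDerivSeries_galAct hπ E hq hE hσ₀ β hσE, ← hv, map_mul, PowerSeries.map_C,
    frobUnitBall_algebraMap E σ₀ v, map_subst_homE hπ (frobUnitBall_algebraMap_LTCoeff E σ₀) v,
    PowerSeries.subst_mul hsf, subst_map_ltSer_C, ← subst_homE_subst_map_ltSer hπ E v,
    PowerSeries.subst_sub hsv, PowerSeries.subst_mul hsv, subst_homE_C]
  ring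

/-! ### The Galois action on the coordinates: `r_{σ̃β} = χ·ρ_χ·(r_β ∘ [χ])` -/

omit [Normal F E] [IsGalois F E] in
/-- **`(1 + u⁻¹X)·(ι ρ_v ∘ f) = 1 + u⁻¹·[v]_f` in `𝒪_E⟦X⟧`** (the defining identity of the twist `ρ_v`, read in `𝒪_E⟦X⟧`).
[cite: deShalit1987, Ch. I §3.4] -/
theorem one_add_mul_subst_map_evenPartTwo_unitTwistSerTwo {t : LTCoeff F} (ht : (2 : LTCoeff F) = LTCoeff.of F π * t)
    (v : 𝒪[F]ˣ) :
    (1 + PowerSeries.C (algebraMap (LTCoeff F) (unitBall E) t) * PowerSeries.X) *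
        PowerSeries.subst ((ltSer F π).map (algebraMap (LTCoeff F) (unitBall E)))
          ((evenPartTwo hπ hq (unitTwistSerTwo hπ t v)).map (algebraMap (LTCoeff F) (unitBall E))) =
      1 + PowerSeries.C (algebraMap (LTCoeff F) (unitBall E) t) * homE hπ E (v : 𝒪[F]) := by
  have hf : PowerSeries.HasSubst (ltSer F π) :=
    PowerSeries.HasSubst.of_constantCoeff_zero' (isLTSeries_ltSer π).constantCoeff_eq_zero
  have h := congrArg (PowerSeries.map (algebraMap (LTCoeff F) (unitBall E)))
    (one_add_mul_subst_evenPartTwo_unitTwistSerTwo hπ hq ht v)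
  have e : PowerSeries.map (algebraMap (LTCoeff F) (unitBall E))
      (PowerSeries.subst (ltSer F π) (evenPartTwo hπ hq (unitTwistSerTwo hπ t v))) =
      PowerSeries.subst ((ltSer F π).map (algebraMap (LTCoeff F) (unitBall E)))
        ((evenPartTwo hπ hq (unitTwistSerTwo hπ t v)).map (algebraMap (LTCoeff F) (unitBall E))) :=
    PowerSeries.map_subst hf _
  rw [map_mul, map_add, map_one, map_mul, PowerSeries.map_C, PowerSeries.map_X, e, map_add, map_one, map_mul,
    PowerSeries.map_C] at h
  exact h

/-- ★★ **De Shalit's Lemma I.3.4 (ii) over `k'` in coordinates**: for `σ̃ ∈ Γ_F` fixing `E` pointwise,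
**`r_{σ̃·β} = χ_π(σ̃) · ι ρ_{χ_π(σ̃)} · (r_β ∘ [χ_π(σ̃)]_f)`** (`π = 2u`; `ρ_v = evenPartTwo (unitTwistSerTwo u⁻¹ v) ∈ 𝒪_F⟦Y⟧ˣ`
with `(1 + u⁻¹X)(ρ_v ∘ f) = 1 + u⁻¹[v]_f`): the semilinear `Gal(E·K_π^∞/E) ≅ 𝒪_F^×`-action on the free rank-one
coordinate module `𝒪_E⟦Y⟧` for which `β ↦ r_β` is equivariant. [cite: deShalit1987, Ch. I §3.4 Lemma (ii)] -/
theorem relUnitCoordTwo_galAct (u : (LTCoeff F)ˣ) (hu : LTCoeff.of F π = residueFieldCard F * u)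
    (β : RelNormCoherentUnits hπ E) {σ : absoluteGaloisGroup F} (hσE : ∀ x : E, σ • (x : AlgebraicClosure F) = x) :
    relUnitCoordTwo hπ E hq hE hσ₀ u hu (β.galAct σ) =
      PowerSeries.C (algebraMap 𝒪[F] (unitBall E) (lubinTateChar hπ σ : 𝒪[F])) *
        (evenPartTwo hπ hq (unitTwistSerTwo hπ (↑u⁻¹ : LTCoeff F) (lubinTateChar hπ σ))).map
          (algebraMap (LTCoeff F) (unitBall E)) *
        (relUnitCoordTwo hπ E hq hE hσ₀ u hu β).subst (homE hπ E (lubinTateChar hπ σ : 𝒪[F])) := by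
  have ht := two_eq_of_mul_inv hq u hu
  set v : 𝒪[F]ˣ := lubinTateChar hπ σ with hv
  have hsv := hasSubst_homE hπ E (v : 𝒪[F])
  have hsf : PowerSeries.HasSubst ((ltSer F π).map (algebraMap (LTCoeff F) (unitBall E))) := hasSubst_map_ltSer E
  symm
  refine eq_relUnitCoordTwo hπ E hq hE hσ₀ u hu _ ?_
  rw [relTildeSeries_galAct hπ E hq hE hσ₀ _ β hσE, ← hv, relTildeSeries_eq_relUnitCoordTwo hπ E hq hE hσ₀ u hu β,
    PowerSeries.subst_mul hsv, PowerSeries.subst_add hsv, PowerSeries.subst_mul hsv, subst_homE_C,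
    PowerSeries.subst_X hsv, ← PowerSeries.coe_substAlgHom hsv, map_one, PowerSeries.coe_substAlgHom,
    subst_homE_subst_map_ltSer hπ E, ← one_add_mul_subst_map_evenPartTwo_unitTwistSerTwo hπ E hq ht v,
    PowerSeries.subst_mul hsf, PowerSeries.subst_mul hsf, subst_map_ltSer_C]
  ring

end RelativeCoordGaloisTwo

end Literature.NumberTheory.GaloisRepresentations
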